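import Mathlib
import Summits.PneNP.PneNP.Theorems.ConvexRankGatesConvexGateBlindRainbowFunctional

/-!
# PneNP / ConvexRankGates — `ConvexGateBlind`: inclusion numbers of the rainbow pseudo-distribution

Helpers (`--supports stmt-PneNP-10680`), continuing `…RainbowFunctional.lean` (the one-clump functional `rbL`, its
linearity, the pinned-fibre product `rbL_sum_pi_indicator` / `card_piFinset_pinFib`, and the superset counts). Main result
(`rbL_indicator`, registered stub `rainbow_marginal`): for a colouring `h : Fin m → Fin K` with classes of common size
`n ≥ K + 1` and `#T ≤ K`,
  `L(𝟙[T ⊆ ·]) = [T rainbow] · K · n^{K - #T} / (K + 1 - #T)`,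
i.e. the functional has exactly the inclusion numbers of "a uniformly random `(K+1)`-set meeting every class at most once"
and gives pseudo-probability ZERO to every non-rainbow pattern. Per class `i` (`rbL_class_sum`) the value is
`[T' rainbow] n^{K-#T'}/C(n,κ) · ∑_{j<K} (-1)^j C(N,j) C(j+2,κ)/((j+1)(j+2))` (`T' = T ∖ cls i`, `κ = #(T ∩ cls i)`,
`N = K-1-#h(T')`, clump size `c = j+2`), and the clump-size sum is `1/(N+2)`, `1/(n(N+1))`, `0` for `κ = 0, 1, ≥ 2` by the
three alternating identities of `…RainbowSums.lean` (`rbL_class_value_of_injOn` / `…_of_not_injOn`). [new]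
-/

namespace Summit.PneNP.PneNP.Theorems

open Finset

noncomputable section

variable {m K : ℕ}

/-- Reflected colour-set count: for `j < K`, `#H < K`: `[#H ≤ K-1-j] · C(K-1-#H, K-1-j-#H) = C(K-1-#H, j)`. -/
theorem colourSets_count_reflect {K : ℕ} (H : Finset (Fin K)) (hHK : H.card < K) {j : ℕ} (hj : j < K) :
    ((if H.card ≤ K - 1 - j then (K - 1 - H.card).choose (K - 1 - j - H.card) else 0 : ℕ) : ℝ) =
      ((K - 1 - H.card).choose j : ℝ) := by
  split_ifs with hle
  · have h2 : j ≤ K - 1 - H.card := by omega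
    have h1 : K - 1 - j - H.card = (K - 1 - H.card) - j := by omega
    rw [h1, Nat.choose_symm h2]
  · push Not at hle
    rw [Nat.choose_eq_zero_of_lt (by omega)]

/-- **Per-class evaluation of `L(𝟙[T ⊆ ·])`.** With `T_i = T ∩ cls i`, `T' = T ∖ T_i`, `H = h(T')`, `κ = #T_i`,
`N = K - 1 - #H`: the class-`i` part of `L(𝟙[T ⊆ ·])` equals
`[T' rainbow] n^{K-#T'} / C(n,κ) · ∑_{j<K} (-1)^j C(N,j) C(j+2,κ) / ((j+1)(j+2))`
(the `x`-sum is the pinned-fibre product, the `Γ`- and `C`-sums are superset counts, the clump size is `c = j + 2`). -/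
theorem rbL_class_sum (h : Fin m → Fin K) {n : ℕ} (hn : ∀ c, (cls h c).card = n) (hKn : K + 1 ≤ n)
    (T : Finset (Fin m)) (i : Fin K) :
    (∑ g ∈ range K, ∑ Γ ∈ (univ.erase i).powersetCard g, ∑ C ∈ (cls h i).powersetCard (K + 1 - g),
        clumpWt n (K + 1 - g) * ∑ x ∈ Fintype.piFinset (fun c => cls h c),
          (if T ⊆ C ∪ Γ.image x then (1 : ℝ) else 0)) =
      (if Set.InjOn h ↑(T.filter fun v => h v ≠ i) then (n : ℝ) ^ (K - (T.filter fun v => h v ≠ i).card) else 0) /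
          (n.choose (T.filter fun v => h v = i).card : ℝ) *
        ∑ j ∈ range K, (-1 : ℝ) ^ j * ((K - 1 - ((T.filter fun v => h v ≠ i).image h).card).choose j : ℝ) *
          ((j + 2).choose (T.filter fun v => h v = i).card : ℝ) / ((j + 1) * (j + 2)) := by
  classical
  set T' := T.filter fun v => h v ≠ i with hT'
  set Ti := T.filter fun v => h v = i with hTi
  set H := T'.image h with hHdef
  set P : ℝ := if Set.InjOn h ↑T' then (n : ℝ) ^ (K - T'.card) else 0 with hP
  have hHsub : H ⊆ univ.erase i := by
    intro c hc
    obtain ⟨v, hv, rfl⟩ := mem_image.1 hc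
    exact mem_erase.2 ⟨(mem_filter.1 hv).2, mem_univ _⟩
  have hTisub : Ti ⊆ cls h i := fun v hv => mem_cls.2 (mem_filter.1 hv).2
  have hHK : H.card < K := by
    have h1 := card_le_card hHsub
    rw [card_erase_of_mem (mem_univ _), card_univ, Fintype.card_fin] at h1
    have : 0 < K := by
      rcases Nat.eq_zero_or_pos K with hK | hK
      · exact absurd i.isLt (by omega)
      · exact hK
    omega
  have hκn : Ti.card ≤ n := (card_le_card hTisub).trans (hn i).le
  have hCnκ : (n.choose Ti.card : ℝ) ≠ 0 := by
    have := Nat.choose_pos hκn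
    positivity
  -- reflect `g = K - 1 - j`
  rw [← Finset.sum_range_reflect, Finset.mul_sum]
  refine Finset.sum_congr rfl fun j hj => ?_
  have hjK : j < K := mem_range.1 hj
  have hg : K + 1 - (K - 1 - j) = j + 2 := by omega
  rw [hg]
  -- Step 1: the `x`-sums
  have step1 : ∀ Γ ∈ (univ.erase i).powersetCard (K - 1 - j), ∀ C ∈ (cls h i).powersetCard (j + 2),
      clumpWt n (j + 2) * (∑ x ∈ Fintype.piFinset (fun c => cls h c), (if T ⊆ C ∪ Γ.image x then (1 : ℝ) else 0)) =
        clumpWt n (j + 2) * (if Ti ⊆ C ∧ H ⊆ Γ then P else 0) := by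
    intro Γ hΓ C hC
    have hiΓ : i ∉ Γ := fun hi => by
      have := (mem_powersetCard.1 hΓ).1 hi
      simp at this
    have hCsub : C ⊆ cls h i := (mem_powersetCard.1 hC).1
    rw [rbL_sum_pi_indicator h hiΓ hCsub T, card_piFinset_pinFib h hn T i]
    have hiff : (∀ v ∈ T, h v ≠ i → h v ∈ Γ) ↔ H ⊆ Γ := by
      rw [hHdef, Finset.image_subset_iff]
      simp only [hT', mem_filter, and_imp]
    rw [← hT', ← hTi]
    congr 1
    by_cases hA : Ti ⊆ C
    · by_cases hB : H ⊆ Γ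
      · rw [if_pos (show Ti ⊆ C ∧ (∀ v ∈ T, h v ≠ i → h v ∈ Γ) from ⟨hA, hiff.2 hB⟩),
          if_pos (show Ti ⊆ C ∧ H ⊆ Γ from ⟨hA, hB⟩), hP]
        push_cast
        rfl
      · rw [if_neg (fun hh : Ti ⊆ C ∧ (∀ v ∈ T, h v ≠ i → h v ∈ Γ) => hB (hiff.1 hh.2)),
          if_neg (fun hh : Ti ⊆ C ∧ H ⊆ Γ => hB hh.2)]
    · rw [if_neg (fun hh : Ti ⊆ C ∧ (∀ v ∈ T, h v ≠ i → h v ∈ Γ) => hA hh.1),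
        if_neg (fun hh : Ti ⊆ C ∧ H ⊆ Γ => hA hh.1)]
  rw [Finset.sum_congr rfl fun Γ hΓ => Finset.sum_congr rfl fun C hC => step1 Γ hΓ C hC]
  -- Step 2: split the double sum
  rw [sum_sum_ite_and]
  -- Step 3: the two counts
  have hNΓ := card_colourSets_superset hHsub (K - 1 - j)
  have hNΓ' : (((((univ.erase i).powersetCard (K - 1 - j)).filter fun Γ => H ⊆ Γ).card : ℕ) : ℝ) =
      ((K - 1 - H.card).choose j : ℝ) := by
    rw [hNΓ]
    exact colourSets_count_reflect H hHK hjK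
  have hNC := card_clumps_superset h hn i hTisub (j + 2)
  have hCn2 : (n.choose (j + 2) : ℝ) ≠ 0 := by
    have := Nat.choose_pos (show j + 2 ≤ n by omega)
    positivity
  -- Step 4: algebra
  rw [hNΓ']
  have hj1 : (j : ℝ) + 1 ≠ 0 := by positivity
  have hj2 : (j : ℝ) + 2 ≠ 0 := by positivity
  have hw : clumpWt n (j + 2) * (n.choose (j + 2) : ℝ) = (-1 : ℝ) ^ j / (((j : ℝ) + 1) * ((j : ℝ) + 2)) := by
    rw [clumpWt]
    have h1 : ((j + 2 : ℕ) : ℝ) = (j : ℝ) + 2 := by push_cast; ring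
    have h3 : (j : ℝ) + 2 - 1 = (j : ℝ) + 1 := by ring
    rw [h1, h3, pow_add, div_mul_eq_mul_div, div_eq_div_iff (by positivity) (by positivity)]
    ring
  -- `NC = C(n,j+2) C(j+2,κ) / C(n,κ)`
  have hNC' : ((((cls h i).powersetCard (j + 2)).filter fun C => Ti ⊆ C).card : ℝ) =
      (n.choose (j + 2) : ℝ) * ((j + 2).choose Ti.card : ℝ) / (n.choose Ti.card : ℝ) := by
    rw [eq_div_iff hCnκ, hNC]
  rw [hNC']
  calc clumpWt n (j + 2) * P * ((K - 1 - H.card).choose j : ℝ) *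
        ((n.choose (j + 2) : ℝ) * ((j + 2).choose Ti.card : ℝ) / (n.choose Ti.card : ℝ))
      = (clumpWt n (j + 2) * (n.choose (j + 2) : ℝ)) * P * ((K - 1 - H.card).choose j : ℝ) *
          ((j + 2).choose Ti.card : ℝ) / (n.choose Ti.card : ℝ) := by ring
    _ = P / (n.choose Ti.card : ℝ) *
          ((-1 : ℝ) ^ j * ((K - 1 - H.card).choose j : ℝ) * ((j + 2).choose Ti.card : ℝ) / ((j + 1) * (j + 2))) := by
        rw [hw]
        field_simp

/-! ## Evaluation of the per-class values -/

/-- Truncation of a `range K` sum whose terms vanish beyond `N < K`. -/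
theorem sum_range_eq_sum_range_of_vanish {K N : ℕ} (hNK : N + 1 ≤ K) (f : ℕ → ℝ)
    (hf : ∀ j, N < j → f j = 0) : ∑ j ∈ range K, f j = ∑ j ∈ range (N + 1), f j := by
  symm
  refine Finset.sum_subset (range_subset_range.2 hNK) fun j _ hj' => hf j ?_
  rw [mem_range, not_lt] at hj'
  omega

/-- `C(j+2, r+2) / ((j+1)(j+2)) = C(j, r) / ((r+1)(r+2))`. [folklore] -/
theorem choose_add_two_div (j r : ℕ) :
    (((j + 2).choose (r + 2) : ℕ) : ℝ) / (((j : ℝ) + 1) * ((j : ℝ) + 2)) =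
      ((j.choose r : ℕ) : ℝ) / (((r : ℝ) + 1) * ((r : ℝ) + 2)) := by
  have h1 := Nat.add_one_mul_choose_eq j r
  have h2 := Nat.add_one_mul_choose_eq (j + 1) (r + 1)
  have h1' : ((j : ℝ) + 1) * (j.choose r : ℝ) = ((j + 1).choose (r + 1) : ℝ) * ((r : ℝ) + 1) := by
    exact_mod_cast h1
  have h2' : ((j : ℝ) + 1 + 1) * ((j + 1).choose (r + 1) : ℝ) =
      ((j + 1 + 1).choose (r + 1 + 1) : ℝ) * ((r : ℝ) + 1 + 1) := by
    exact_mod_cast h2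
  have h22 : (j + 1 + 1).choose (r + 1 + 1) = (j + 2).choose (r + 2) := rfl
  rw [h22] at h2'
  rw [div_eq_div_iff (by positivity) (by positivity)]
  linear_combination (-((r : ℝ) + 1)) * h2' - ((j : ℝ) + 2) * h1'

/-- The per-class value when `T` is rainbow: `n^{K - #T} / (K + 1 - #T)` for EVERY class. -/
theorem rbL_class_value_of_injOn (h : Fin m → Fin K) {n : ℕ} (hKn : K + 1 ≤ n) {T : Finset (Fin m)}
    (hinj : Set.InjOn h ↑T) (hT : T.card ≤ K) (i : Fin K) :
    (if Set.InjOn h ↑(T.filter fun v => h v ≠ i) then (n : ℝ) ^ (K - (T.filter fun v => h v ≠ i).card) else 0) /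
          (n.choose (T.filter fun v => h v = i).card : ℝ) *
        ∑ j ∈ range K, (-1 : ℝ) ^ j * ((K - 1 - ((T.filter fun v => h v ≠ i).image h).card).choose j : ℝ) *
          ((j + 2).choose (T.filter fun v => h v = i).card : ℝ) / ((j + 1) * (j + 2)) =
      (n : ℝ) ^ (K - T.card) / ((K : ℝ) + 1 - T.card) := by
  classical
  set T' := T.filter fun v => h v ≠ i with hT'
  set Ti := T.filter fun v => h v = i with hTi
  set H := T'.image h with hHdef
  have hinj' : Set.InjOn h ↑T' := hinj.mono (by rw [hT']; exact coe_subset.2 (filter_subset _ _))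
  have hH : H.card = T'.card := card_image_of_injOn hinj'
  have hsplit : Ti.card + T'.card = T.card := by
    have := Finset.card_filter_add_card_filter_not (s := T) (fun v => h v = i)
    rw [← hTi] at this
    convert this using 2
  have hHK : H.card ≤ K - 1 := by
    have hHsub : H ⊆ univ.erase i := by
      intro c hc
      obtain ⟨v, hv, rfl⟩ := mem_image.1 hc
      exact mem_erase.2 ⟨(mem_filter.1 hv).2, mem_univ _⟩
    have h1 := card_le_card hHsub
    rwa [card_erase_of_mem (mem_univ _), card_univ, Fintype.card_fin] at h1
  have hKpos : 0 < K := by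
    rcases Nat.eq_zero_or_pos K with hK | hK
    · exact absurd i.isLt (by omega)
    · exact hK
  have hn0 : (n : ℝ) ≠ 0 := by
    have : 0 < n := by omega
    positivity
  have hκ : Ti.card ≤ 1 := Finset.card_le_one.2 fun a ha b hb =>
    hinj (mem_coe.2 (mem_filter.1 ha).1) (mem_coe.2 (mem_filter.1 hb).1)
      ((mem_filter.1 ha).2.trans (mem_filter.1 hb).2.symm)
  rw [if_pos hinj', hH]
  rcases Nat.le_one_iff_eq_zero_or_eq_one.1 hκ with h0 | h1
  · -- the clump class is not a colour of `T`
    rw [h0]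
    have hT'card : T'.card = T.card := by omega
    have hTK : T.card ≤ K - 1 := by omega
    simp only [Nat.choose_zero_right, Nat.cast_one, div_one, mul_one]
    rw [hT'card]
    set N := K - 1 - T.card with hN
    have hsum : ∑ j ∈ range K, (-1 : ℝ) ^ j * (N.choose j : ℝ) / ((j + 1) * (j + 2)) = 1 / ((N : ℝ) + 2) := by
      rw [sum_range_eq_sum_range_of_vanish (N := N) (by omega) _ (fun j hj => by
        rw [Nat.choose_eq_zero_of_lt hj]; simp)]
      exact rb_alt_sum_choose_div_succ_succ N
    rw [hsum]
    have hNcast : (N : ℝ) + 2 = (K : ℝ) + 1 - T.card := by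
      rw [hN]
      push_cast [Nat.cast_sub hTK, Nat.cast_sub (show 1 ≤ K from hKpos)]
      ring
    rw [hNcast]
    ring
  · -- the clump class carries exactly one vertex of `T`
    rw [h1]
    have hT1 : 1 ≤ T.card := by omega
    have hT'card : T'.card = T.card - 1 := by omega
    simp only [Nat.choose_one_right]
    rw [hT'card]
    set N := K - T.card with hN
    have hNeq : K - 1 - (T.card - 1) = N := by omega
    rw [hNeq]
    have hsum : ∑ j ∈ range K, (-1 : ℝ) ^ j * (N.choose j : ℝ) * ((j + 2 : ℕ) : ℝ) / ((j + 1) * (j + 2)) =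
        1 / ((N : ℝ) + 1) := by
      have hterm : ∀ j ∈ range K, (-1 : ℝ) ^ j * (N.choose j : ℝ) * ((j + 2 : ℕ) : ℝ) / ((j + 1) * (j + 2)) =
          (-1 : ℝ) ^ j * (N.choose j : ℝ) / (j + 1) := by
        intro j _
        have hj2 : (j : ℝ) + 2 ≠ 0 := by positivity
        have hj1 : (j : ℝ) + 1 ≠ 0 := by positivity
        push_cast
        field_simp
      rw [Finset.sum_congr rfl hterm]
      rw [sum_range_eq_sum_range_of_vanish (N := N) (by omega) _ (fun j hj => by
        rw [Nat.choose_eq_zero_of_lt hj]; simp)]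
      exact rb_alt_sum_choose_div_succ N
    rw [hsum]
    have hpow : (n : ℝ) ^ (K - (T.card - 1)) = (n : ℝ) ^ (K - T.card) * n := by
      rw [show K - (T.card - 1) = (K - T.card) + 1 by omega, pow_succ]
    rw [hpow]
    have hNcast : (N : ℝ) + 1 = (K : ℝ) + 1 - T.card := by
      rw [hN]
      push_cast [Nat.cast_sub hT]
      ring
    rw [hNcast]
    have hden : (K : ℝ) + 1 - T.card ≠ 0 := by
      have : (T.card : ℝ) ≤ K := by exact_mod_cast hT
      linarith
    field_simp
    rw [hN]

/-- The per-class value when `T` is NOT rainbow: zero (either the class-`i`-free part of `T` already collides, or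
the collision is inside class `i` and the clump-size sum is `∑ (-1)^j C(N,j) C(j,κ-2) = 0`). -/
theorem rbL_class_value_of_not_injOn (h : Fin m → Fin K) {n : ℕ} {T : Finset (Fin m)}
    (hninj : ¬ Set.InjOn h ↑T) (hT : T.card ≤ K) (i : Fin K) :
    (if Set.InjOn h ↑(T.filter fun v => h v ≠ i) then (n : ℝ) ^ (K - (T.filter fun v => h v ≠ i).card) else 0) /
          (n.choose (T.filter fun v => h v = i).card : ℝ) *
        ∑ j ∈ range K, (-1 : ℝ) ^ j * ((K - 1 - ((T.filter fun v => h v ≠ i).image h).card).choose j : ℝ) *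
          ((j + 2).choose (T.filter fun v => h v = i).card : ℝ) / ((j + 1) * (j + 2)) = 0 := by
  classical
  set T' := T.filter fun v => h v ≠ i with hT'
  set Ti := T.filter fun v => h v = i with hTi
  set H := T'.image h with hHdef
  by_cases hinj' : Set.InjOn h ↑T'
  · -- the collision is inside class `i`: `κ ≥ 2`
    have hcoll : ∃ a ∈ T, ∃ b ∈ T, h a = h b ∧ a ≠ b := by
      by_contra hno
      push Not at hno
      exact hninj fun a ha b hb hab => hno a (mem_coe.1 ha) b (mem_coe.1 hb) hab
    obtain ⟨a, ha, b, hb, hab, hne⟩ := hcoll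
    have hai : h a = i := by
      by_contra hai
      have hbi : h b ≠ i := fun hbi => hai (hab.trans hbi)
      exact hne (hinj' (mem_coe.2 (mem_filter.2 ⟨ha, hai⟩)) (mem_coe.2 (mem_filter.2 ⟨hb, hbi⟩)) hab)
    have hbi : h b = i := hab ▸ hai
    have hκ2 : 2 ≤ Ti.card := by
      have : 1 < Ti.card := Finset.one_lt_card.2 ⟨a, mem_filter.2 ⟨ha, hai⟩, b, mem_filter.2 ⟨hb, hbi⟩, hne⟩
      omega
    have hH : H.card = T'.card := card_image_of_injOn hinj'
    have hsplit : Ti.card + T'.card = T.card := by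
      have := Finset.card_filter_add_card_filter_not (s := T) (fun v => h v = i)
      rw [← hTi] at this
      convert this using 2
    obtain ⟨r, hr⟩ : ∃ r, Ti.card = r + 2 := ⟨Ti.card - 2, by omega⟩
    rw [hr, hH]
    set N := K - 1 - T'.card with hN
    have hrN : r < N := by omega
    have hNK : N + 1 ≤ K := by omega
    have hsum : ∑ j ∈ range K, (-1 : ℝ) ^ j * (N.choose j : ℝ) * ((j + 2).choose (r + 2) : ℝ) / ((j + 1) * (j + 2)) = 0 := by
      have hterm : ∀ j ∈ range K, (-1 : ℝ) ^ j * (N.choose j : ℝ) * ((j + 2).choose (r + 2) : ℝ) / ((j + 1) * (j + 2)) =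
          (1 / (((r : ℝ) + 1) * ((r : ℝ) + 2))) * ((-1 : ℝ) ^ j * (N.choose j : ℝ) * (j.choose r : ℝ)) := by
        intro j _
        have := choose_add_two_div j r
        rw [mul_div_assoc, this]
        ring
      rw [Finset.sum_congr rfl hterm, ← Finset.mul_sum]
      rw [sum_range_eq_sum_range_of_vanish (N := N) hNK _ (fun j hj => by
        rw [Nat.choose_eq_zero_of_lt hj]; simp)]
      rw [rb_alt_sum_choose_mul_choose hrN, mul_zero]
    rw [hsum, mul_zero]
  · rw [if_neg hinj']
    simp

/-- **Inclusion numbers of the rainbow pseudo-distribution.** For a colouring with classes of common size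
`n ≥ K + 1` and a set `T` of at most `K` vertices:
`L(𝟙[T ⊆ ·]) = [T rainbow] · K · n^{K - #T} / (K + 1 - #T)`. -/
theorem rbL_indicator (h : Fin m → Fin K) {n : ℕ} (hn : ∀ c, (cls h c).card = n) (hKn : K + 1 ≤ n)
    (T : Finset (Fin m)) (hT : T.card ≤ K) :
    rbL h n (fun Q => if T ⊆ Q then 1 else 0) =
      if Set.InjOn h ↑T then (K : ℝ) * (n : ℝ) ^ (K - T.card) / ((K : ℝ) + 1 - T.card) else 0 := by
  classical
  unfold rbL
  rw [Finset.sum_congr rfl fun i _ => rbL_class_sum h hn hKn T i]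
  split_ifs with hinj
  · rw [Finset.sum_congr rfl fun i _ => rbL_class_value_of_injOn h hKn hinj hT i, Finset.sum_const, card_univ,
      Fintype.card_fin, nsmul_eq_mul]
    ring
  · exact Finset.sum_eq_zero fun i _ => rbL_class_value_of_not_injOn h hinj hT i

/-- **Registered helper stub (inclusion numbers of the rainbow pseudo-distribution).** Restatement of
`rbL_indicator` with all parameters explicit. -/
theorem rainbow_marginal : ∀ {m K n : ℕ} (h : Fin m → Fin K), (∀ c, (cls h c).card = n) → K + 1 ≤ n → ∀ (T : Finset (Fin m)), T.card ≤ K → rbL h n (fun Q => if T ⊆ Q then 1 else 0) = if Set.InjOn h ↑T then (K : ℝ) * (n : ℝ) ^ (K - T.card) / ((K : ℝ) + 1 - T.card) else 0 := by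
  intro m K n h hn hKn T hT
  exact rbL_indicator h hn hKn T hT

end

end Summit.PneNP.PneNP.Theorems
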